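import Summits.HubbardSuperconductivity.HubbardSuperconductivity.Theses.IsoperimetricCascade

/-!
# Route `IsoperimetricCascade` — support `MaclaurinEndpoint` (stmt-HubbardSuperconductivity-11987)

The isoperimetric engine of the route (card P1): a positive sequence `μ₀ = 1, μ₁, …, μₙ` with
log-concavity defect `μ_k μ_{k+2} ≤ e^c μ_{k+1}²` (`c ≥ 0`, `k + 2 ≤ n`) satisfies
`μₙ ≤ e^{c n(n-1)/2} μ₁ⁿ` (for `c = 0` this is Newton–Maclaurin's endpoint / Minkowski's first
inequality read on a finite sequence).

Proof (multiplicative form of "`b_k := log μ_k - c k²/2` is concave with `b₀ = 0`, hence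
`bₙ ≤ n b₁`"): first the RATIO bound `μ_{k+1} ≤ μ₁ e^{ck} μ_k` for `k + 1 ≤ n` by induction on `k`
(the defect inequality divided by `μ_k > 0`), then `μ_m ≤ e^{c m(m-1)/2} μ₁^m` for `m ≤ n` by
induction on `m` (`c m + c m(m-1)/2 = c (m+1)m/2`). Elementary real analysis; no new definitions.
(The hypothesis `0 ≤ c` of the item is not even needed.) Context: Newton's inequalities /
hyperbolic polynomials, doi:10.1090/s0273-0979-02-00941-2; nothing beyond the two inductions is used.
-/

-- the mandated namespace `Summit.<Summit>.<Problem>.Theorems` repeats `HubbardSuperconductivity`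
-- (single-problem summit, D-0017), which the `dupNamespace` linter flags on every declaration
set_option linter.dupNamespace false

namespace Summit.HubbardSuperconductivity.HubbardSuperconductivity.Theorems

/-- Ratio form of the log-concavity defect: if `μ_k μ_{k+2} ≤ e^c μ_{k+1}²` for `k + 2 ≤ n`,
`μ₀ = 1` and `μ_k > 0` for `k ≤ n`, then `μ_{k+1} ≤ μ₁ · e^{ck} · μ_k` for every `k + 1 ≤ n`.
Induction on `k`. [folklore] -/
theorem maclaurin_ratio_bound (μ : ℕ → ℝ) (n : ℕ) (c : ℝ) (h0 : μ 0 = 1)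
    (hpos : ∀ k ≤ n, 0 < μ k)
    (hdef : ∀ k : ℕ, k + 2 ≤ n → μ k * μ (k + 2) ≤ Real.exp c * μ (k + 1) ^ 2) :
    ∀ k : ℕ, k + 1 ≤ n → μ (k + 1) ≤ μ 1 * Real.exp (c * k) * μ k := by
  intro k
  induction k with
  | zero =>
    intro _
    simp [h0]
  | succ k ih =>
    intro hk
    have hk1 : k + 1 ≤ n := by omega
    have hμk : 0 < μ k := hpos k (by omega)
    have hμk1 : 0 < μ (k + 1) := hpos (k + 1) hk1
    have hIH := ih hk1
    have hd := hdef k (by omega)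
    have hratio : μ (k + 1) / μ k ≤ μ 1 * Real.exp (c * k) := by
      rw [div_le_iff₀ hμk]
      exact hIH
    have h1 : μ (k + 2) ≤ Real.exp c * μ (k + 1) * (μ (k + 1) / μ k) := by
      have hrew : Real.exp c * μ (k + 1) * (μ (k + 1) / μ k) =
          Real.exp c * μ (k + 1) ^ 2 / μ k := by
        rw [pow_two]
        ring
      rw [hrew, le_div_iff₀ hμk]
      calc μ (k + 2) * μ k = μ k * μ (k + 2) := mul_comm _ _
        _ ≤ Real.exp c * μ (k + 1) ^ 2 := hd
    have h2 : Real.exp c * μ (k + 1) * (μ (k + 1) / μ k) ≤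
        Real.exp c * μ (k + 1) * (μ 1 * Real.exp (c * k)) :=
      mul_le_mul_of_nonneg_left hratio (by positivity)
    have h3 : Real.exp c * μ (k + 1) * (μ 1 * Real.exp (c * k)) =
        μ 1 * Real.exp (c * ((k + 1 : ℕ) : ℝ)) * μ (k + 1) := by
      have hexp : Real.exp (c * ((k + 1 : ℕ) : ℝ)) = Real.exp (c * k) * Real.exp c := by
        rw [← Real.exp_add]
        push_cast
        ring_nf
      rw [hexp]
      ring
    calc μ (k + 1 + 1) = μ (k + 2) := rfl
      _ ≤ Real.exp c * μ (k + 1) * (μ (k + 1) / μ k) := h1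
      _ ≤ Real.exp c * μ (k + 1) * (μ 1 * Real.exp (c * k)) := h2
      _ = μ 1 * Real.exp (c * ((k + 1 : ℕ) : ℝ)) * μ (k + 1) := h3

/-- Cumulative form: `μ_m ≤ e^{c m(m-1)/2} μ₁^m` for every `m ≤ n`, by induction on `m` from the
ratio bound. [folklore] -/
theorem maclaurin_cumulative_bound (μ : ℕ → ℝ) (n : ℕ) (c : ℝ) (h0 : μ 0 = 1)
    (hpos : ∀ k ≤ n, 0 < μ k)
    (hdef : ∀ k : ℕ, k + 2 ≤ n → μ k * μ (k + 2) ≤ Real.exp c * μ (k + 1) ^ 2) :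
    ∀ m : ℕ, m ≤ n → μ m ≤ Real.exp (c * ((m : ℝ) * ((m : ℝ) - 1) / 2)) * μ 1 ^ m := by
  intro m
  induction m with
  | zero =>
    intro _
    simp [h0]
  | succ m ih =>
    intro hm
    have hIH := ih (by omega)
    have hr := maclaurin_ratio_bound μ n c h0 hpos hdef m hm
    have hμ1 : 0 < μ 1 := hpos 1 (by omega)
    have h1 : μ 1 * Real.exp (c * m) * μ m ≤
        μ 1 * Real.exp (c * m) * (Real.exp (c * ((m : ℝ) * ((m : ℝ) - 1) / 2)) * μ 1 ^ m) :=
      mul_le_mul_of_nonneg_left hIH (by positivity)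
    have h2 : μ 1 * Real.exp (c * m) * (Real.exp (c * ((m : ℝ) * ((m : ℝ) - 1) / 2)) * μ 1 ^ m) =
        Real.exp (c * (((m + 1 : ℕ) : ℝ) * (((m + 1 : ℕ) : ℝ) - 1) / 2)) * μ 1 ^ (m + 1) := by
      have hexp : Real.exp (c * (((m + 1 : ℕ) : ℝ) * (((m + 1 : ℕ) : ℝ) - 1) / 2)) =
          Real.exp (c * m) * Real.exp (c * ((m : ℝ) * ((m : ℝ) - 1) / 2)) := by
        rw [← Real.exp_add]
        push_cast
        ring_nf
      rw [hexp, pow_succ]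
      ring
    calc μ (m + 1) ≤ μ 1 * Real.exp (c * m) * μ m := hr
      _ ≤ μ 1 * Real.exp (c * m) * (Real.exp (c * ((m : ℝ) * ((m : ℝ) - 1) / 2)) * μ 1 ^ m) := h1
      _ = Real.exp (c * (((m + 1 : ℕ) : ℝ) * (((m + 1 : ℕ) : ℝ) - 1) / 2)) * μ 1 ^ (m + 1) := h2

/-- **MaclaurinEndpoint** (item `stmt-HubbardSuperconductivity-11987`): a positive sequence
`μ₀ = 1, μ₁, …, μₙ` with log-concavity defect `μ_k μ_{k+2} ≤ e^c μ_{k+1}²` (`k + 2 ≤ n`) obeys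
`μₙ ≤ e^{c n(n-1)/2} μ₁ⁿ`. The case `m = n` of `maclaurin_cumulative_bound`. [folklore] -/
theorem maclaurinEndpoint_proof :
    Summit.HubbardSuperconductivity.HubbardSuperconductivity.Theses.IsoperimetricCascade.MaclaurinEndpoint := by
  unfold Summit.HubbardSuperconductivity.HubbardSuperconductivity.Theses.IsoperimetricCascade.MaclaurinEndpoint
  intro μ n c _ h0 hpos hdef
  exact maclaurin_cumulative_bound μ n c h0 hpos hdef n le_rfl

end Summit.HubbardSuperconductivity.HubbardSuperconductivity.Theorems
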